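import Summits.BirchSwinnertonDyer.BirchSwinnertonDyer.Theses.TameQuarticManinParity
import Summits.BirchSwinnertonDyer.BirchSwinnertonDyer.Theorems.TameQuarticManinParityTwistLatticeDichotomyOfOptimalTwist
import Summits.BirchSwinnertonDyer.BirchSwinnertonDyer.Theorems.TameQuarticManinParityOrientationOfManinTwistEquality
import Summits.BirchSwinnertonDyer.BirchSwinnertonDyer.Theorems.TameQuarticManinParityOptimalTwistNeronLattice
import Summits.BirchSwinnertonDyer.BirchSwinnertonDyer.Theorems.TameQuarticManinParityTwistPairManinDivisibility
import Summits.BirchSwinnertonDyer.BirchSwinnertonDyer.Theorems.TameQuarticManinParityTwistPartnerOptimalDatumOfFacts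
import Summits.BirchSwinnertonDyer.BirchSwinnertonDyer.Theorems.TameQuarticManinParityDegreePrimeToThreeOfCNS
import Summits.BirchSwinnertonDyer.BirchSwinnertonDyer.Theorems.TameQuarticManinParityIrrOrganOfPub
import Literature.NumberTheory.EllipticCurves.IsogenyPotentiallyGoodMinimalDiscriminantProofs
import HarnessLib

/-!
# Route `TameQuarticManinParity`, LINE 27 (bsd-idea-3 g8): ORIENTATION FROM UNITS — the orientation O22
# `TprimeIrrTwistLatticeOrientation` (stmt-28139) follows from X22 ∧ the ČNS half ∧ [3 ∤ c on the Kodaira-III rows]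
# (glue GO27 `TprimeIrrOrientationOfIIIRowsManinUnit`, stmt-BirchSwinnertonDyer-23090; planner's proof, landed by the
# prover seat per D-0016)

Cell `pub/bsd-wall`, D-0145 line `route-BirchSwinnertonDyer-TeichmullerTwistDescent`, seat `bsd-line-ttd-p1` g11,
working the planner-of-record's TQMP LINE 27. The PROOF is planner bsd-idea-3 g8's
(`ideas/l26/Certificate26_irreducible_crux_residue_byname.lean`, 18:15Z, kernel-checked), re-checked against the tree
and wrapped in the Theorems conventions; the lemmas it uses (`eq_of_isQuadratic_isPrimitive_three`,
`exists_transport_datum`, `cuspCoeff_rel_of_twist_negThree`, `periodLattice_eq_of_level_eq_of_cuspCoeff_eq`) are the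
tree's (landed with GD26, `TameQuarticManinParityTwistLatticeDichotomyOfOptimalTwist`).

MECHANISM. For `W` of Kodaira type III take, via X22 twice, the optimal pair: `A₂ ∼ W` of type III with its
lattice-optimal degree-minimal conductor-level datum `D₂`, and `A₁` of type III* with `D₁` transported to level `N(W)`;
`c(D₂)` is a `3`-unit — by the III-rows hypothesis if `3 ∣ deg D₂`, by the ČNS half if not; M25 (closed item 22695,
`c′ ∣ c ∣ 3c′`) forces `c(D₂) = ±c(D₁)`; K25 (closed item 22696, granted T24L = closed item 22694) gives
`Λ(D₂.f) ⊆ g(χ₋₃)·Λ(D₂.f ⊗ χ₋₃)`; newform identification (twist relations on cusp coefficients, multiplicity one)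
transports the inclusion to the given datum `D` of `W`.

CONSEQUENCE FOR THE DAG (numbers, not adjectives): the orientation organ O22 28139 ≡ N24 22545 is DOWNSTREAM of the
III-rows unit statement (verbatim the hypothesis of the closed glue G22′ 28157), which the irreducible crux
`TprimeIrreducibleManinUnit` (rank 2) needs anyway on the G22′ path (`tprimeIrreducibleManinUnit_of_pub_of_III`,
landed in `TameQuarticManinParityIrrOrganOfPub`). GRANTED the three published inputs {modularity `exists_isNewformOf`,
Dokchitser–Dokchitser 2015 Thm 5.1(1), Česnavičius–Neururer–Saha Thm 1.2}, O22 ⟸ the III-rows unit statement ALONE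
(`tprimeIrrTwistLatticeOrientation_of_pub_of_III` below).

BSD is NOT proved by this; Manin's conjecture at 3 is not proved; O22 28139, the organ 24498 and the crux 23736 stay
OPEN (the III-rows unit statement is an explicit hypothesis everywhere). Design: theorems only (no definition, no new
named fact, no `sorry`); axioms `propext`, `Classical.choice`, `Quot.sound`.
-/

noncomputable section

set_option autoImplicit false
-- D-0017: single-problem summit, so `Summit.BirchSwinnertonDyer.BirchSwinnertonDyer.…` repeats a namespace BY DESIGN.
set_option linter.dupNamespace false

namespace Summit.BirchSwinnertonDyer.BirchSwinnertonDyer.Theorems.TameQuarticManinParity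

open Summit.BirchSwinnertonDyer.BirchSwinnertonDyer.Theses.TameQuarticManinParity
open Literature.NumberTheory.EllipticCurves Literature.NumberTheory.EllipticCurves.ModularForms WeierstrassCurve

section OrientationOfUnits

open scoped Classical
open IsDedekindDomain Rat.HeightOneSpectrum
  Literature.NumberTheory.EllipticCurves.Rank1Residual
  Summit.BirchSwinnertonDyer.Rank1Residual Summit.BirchSwinnertonDyer.Rank1Residual.Additive
  Summit.BirchSwinnertonDyer.Rank1Residual.ManinAdditive

set_option maxHeartbeats 800000 in
/-- **O22 ⟸ X22 ∧ ČNS half ∧ [3 ∤ c on the Kodaira-III rows]** (planner bsd-idea-3 g8, LINE 27). The third hypothesis is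
VERBATIM the III-rows half of the organ 24498 (the hypothesis of the closed glue `TprimeIrrManinUnitOfIIIHalf`,
stmt-28157): `W` non-CM, (t′) at 3, `E[3]` irreducible, `ord₃ Δ_min = 3`, `D` lattice-optimal and degree-minimal at
conductor level, `3 ∣ deg φ` ⟹ `3 ∤ c`. [cite: Stevens1989, Lemmas (5.2), (5.4)]
[cite: CesnaviciusNeururerSaha2023, Thm. 1.2] -/
theorem tprimeIrrTwistLatticeOrientation_of_partner_of_cns_of_IIIRows
    (hX : TprimeIrrTwistPartnerOptimalDatum) (hCNS : TprimeIrrManinUnitOfDegreePrimeToThree)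
    (hIII : ∀ (W : WeierstrassCurve ℚ) [W.IsElliptic] [W.IsGloballyMinimal] [NeZero (W.conductorNorm ℤ)], ¬ W.HasCM → Literature.NumberTheory.EllipticCurves.Rank1Residual.Addv W 3 → Summit.BirchSwinnertonDyer.Rank1Residual.Additive.SubTprime W 3 → W.HasIrreducibleModPGaloisRep 3 → padicValInt 3 W.minimalDiscriminantInt = 3 → ∀ (D : Literature.NumberTheory.EllipticCurves.ModularForms.ModularParametrizationData W (W.conductorNorm ℤ)), (∀ z ∈ D.L.lattice, ∃ w ∈ Literature.NumberTheory.EllipticCurves.ModularForms.periodLattice D.f, z = D.c * w) → (∀ (W' : WeierstrassCurve ℚ) [W'.IsElliptic] (D' : Literature.NumberTheory.EllipticCurves.ModularForms.ModularParametrizationData W' (W.conductorNorm ℤ)), D'.f = D.f → D.modularDegree ≤ D'.modularDegree) → 3 ∣ D.modularDegree → ¬ (3 : ℤ) ∣ D.maninConstant) :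
    TprimeIrrTwistLatticeOrientation := by
  intro W _ _ _ hcm hadd ht hirr h3 D h9 χ hχ hprim
  have hT := tprimeIrrOptimalTwistNeronLattice_proof
  have hM := tprimeIrrTwistPairManinDivisibility_proof
  have hK := tprimeIrrOrientationOfManinTwistEquality_proof
  have hp2 : (3 : ℕ) ≠ 2 := by norm_num
  obtain rfl := eq_of_isQuadratic_isPrimitive_three χ _ hχ hprim
    (isQuadratic_quadraticChar_ringHomComp 3) (isPrimitive_quadraticChar_ringHomComp 3 hp2)
  -- X22 twice
  obtain ⟨A₁, _, _, _, hsum₁, hiso₁, hcm₁, hadd₁, ht₁, hirr₁, hN₁, D₁, hex₁, hmin₁⟩ := hX W hcm hadd ht hirr D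
  obtain ⟨A₂, _, _, _, hsum₂, hiso₂, hcm₂, hadd₂, ht₂, hirr₂, hN₂, D₂, hex₂, hmin₂⟩ :=
    hX A₁ hcm₁ hadd₁ ht₁ hirr₁ D₁
  have r₁ := fun n ↦ cuspCoeff_rel_of_twist_negThree hadd hadd₁ hiso₁ D D₁ n
  have r₂ := fun n ↦ cuspCoeff_rel_of_twist_negThree hadd₁ hadd₂ hiso₂ D₁ D₂ n
  set χ₀ : DirichletCharacter ℂ 3 := (quadraticChar (ZMod 3)).ringHomComp (Int.castRingHom ℂ) with hχ₀
  have hχ0sq : ∀ n : ℕ, ∀ x : ℂ, χ₀ n * (χ₀ n * x) = x ∨ χ₀ n = 0 := by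
    intro n x
    rcases hχ n with h0 | h1 | h1
    · exact Or.inr h0
    · left; rw [h1]; ring
    · left; rw [h1]; ring
  have h9₂ : 3 ^ 2 ∣ A₂.conductorNorm ℤ := (hN₂.trans hN₁) ▸ h9
  -- `W` is of type III, so `A₁` is III* and `A₂ ∼ W` is the type-III optimal member
  have h3₂ : padicValInt 3 A₂.minimalDiscriminantInt = 3 := by omega
  obtain ⟨DS, hexS, hminS, hfS⟩ := exists_transport_datum hN₂.symm D₁ hex₁ hmin₁
  have hf : DS.f = charTwist (A₂.conductorNorm ℤ) (dvd_refl _) h9₂ hχ D₂.f := by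
    refine eq_of_forall_cuspCoeff_eq_gamma0 fun n ↦ ?_
    rw [hfS n, cuspCoeff_charTwist _ _ _ hχ hprim, (r₂ n).1]
  -- the optimal type-III Manin constant is a `3`-unit: III-rows hypothesis if `3 ∣ deg`, ČNS half otherwise
  have hunit : ¬ (3 : ℤ) ∣ D₂.c := by
    by_cases hdeg : 3 ∣ D₂.modularDegree
    · exact hIII A₂ hcm₂ hadd₂ ht₂ hirr₂ h3₂ D₂ hex₂ hmin₂ hdeg
    · exact hCNS A₂ hcm₂ hadd₂ ht₂ hirr₂ D₂ hex₂ hmin₂ hdeg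
  -- M25: `c′ ∣ c ∣ 3c′`, hence `c = ±c′`
  obtain ⟨⟨k, hk⟩, ⟨m, hm⟩⟩ := hM A₂ hcm₂ hadd₂ ht₂ hirr₂ h3₂ D₂ hex₂ hmin₂ h9₂ χ₀ hχ hprim A₁ DS hf hexS hminS
  have hc0 : D₂.c ≠ 0 := D₂.maninConstant_ne_zero_holds
  have hc0' : DS.c ≠ 0 := DS.maninConstant_ne_zero_holds
  have hkm : k * m = 3 := by
    have : DS.c * (k * m) = DS.c * 3 := by rw [← mul_assoc, ← hk, ← hm]; ring
    exact mul_left_cancel₀ hc0' this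
  have hceq : D₂.c = DS.c ∨ D₂.c = -DS.c := by
    have hdvd : k ∣ 3 := ⟨m, hkm.symm⟩
    have hnat : k.natAbs ∣ 3 := by exact_mod_cast Int.natAbs_dvd_natAbs.mpr hdvd
    rcases (Nat.dvd_prime Nat.prime_three).mp hnat with h1 | h3'
    · rcases Int.natAbs_eq k with h | h <;> rw [h1] at h
      · left; rw [hk, h]; simp
      · right; rw [hk, h]; simp
    · exfalso; apply hunit
      rcases Int.natAbs_eq k with h | h <;> rw [h3'] at h
      · exact ⟨DS.c, by rw [hk, h]; push_cast; ring⟩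
      · exact ⟨-DS.c, by rw [hk, h]; push_cast; ring⟩
  have key := hK hT A₂ hcm₂ hadd₂ ht₂ hirr₂ h3₂ D₂ hex₂ hmin₂ h9₂ χ₀ hχ hprim A₁ DS hf hexS hminS hc0 hceq
  -- transport to the given datum `D` of `W`
  have hDD₂ : ∀ n : ℕ, cuspCoeff D.f n = cuspCoeff D₂.f n := by
    intro n
    rcases hχ0sq n (cuspCoeff D₂.f n) with h | h
    · rw [(r₁ n).1, (r₂ n).1, h]
    · rw [(r₁ n).1, (r₂ n).2, h, zero_mul]
  have hL1 : periodLattice D.f = periodLattice D₂.f :=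
    periodLattice_eq_of_level_eq_of_cuspCoeff_eq (hN₂.trans hN₁).symm D.f D₂.f hDD₂
  have hL2 : periodLattice (charTwist (W.conductorNorm ℤ) (dvd_refl _) h9 hχ D.f) =
      periodLattice (charTwist (A₂.conductorNorm ℤ) (dvd_refl _) h9₂ hχ D₂.f) :=
    periodLattice_eq_of_level_eq_of_cuspCoeff_eq (hN₂.trans hN₁).symm _ _ fun n ↦ by
      rw [cuspCoeff_charTwist _ _ _ hχ hprim, cuspCoeff_charTwist _ _ _ hχ hprim, hDD₂ n]
  rw [hL1, hL2]
  exact key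

end OrientationOfUnits

/-- **Glue GO27 `TprimeIrrOrientationOfIIIRowsManinUnit` (stmt-BirchSwinnertonDyer-23090), proved by name**:
X22 → ČNS half → [3 ∤ c on the Kodaira-III rows] → O22 (planner bsd-idea-3 g8's LINE-27 composition «orientation
from units»). [cite: Stevens1989, Lemmas (5.2), (5.4)] [cite: CesnaviciusNeururerSaha2023, Thm. 1.2] -/
theorem tprimeIrrOrientationOfIIIRowsManinUnit_proof : TprimeIrrOrientationOfIIIRowsManinUnit := by
  unfold TprimeIrrOrientationOfIIIRowsManinUnit
  intro hX hCNS hIII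
  exact tprimeIrrTwistLatticeOrientation_of_partner_of_cns_of_IIIRows hX hCNS hIII

/-- **GRANTED THE TWO PUBLISHED INPUTS** (modularity `exists_isNewformOf` and Česnavičius–Neururer–Saha Thm 1.2 —
cite-only named facts of the tree, taken as hypotheses: a CONDITIONAL result), **the orientation O22
`TprimeIrrTwistLatticeOrientation` (stmt-28139) follows from the III-rows unit statement ALONE.** Dokchitser–Dokchitser
2015 Thm. 5.1 (1), the third input of X22, is the tree's THEOREM
`dokchitser_padicValInt_minimalDiscriminantInt_eq_of_isogeny_of_not_dvd_degree_holds` and is discharged here.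
[cite: BCDTJAMS2001, Thm. A] [cite: DokchitserDokchitser2015LocalInvariants, Thm. 5.1 (1)]
[cite: CesnaviciusNeururerSaha2023, Thm. 1.2] -/
theorem tprimeIrrTwistLatticeOrientation_of_pub_of_III (hnf : exists_isNewformOf)
    (hCNS : cesnaviciusNeururerSaha_padicVal_maninConstant_le_modularDegree)
    (hIII : ∀ (W : WeierstrassCurve ℚ) [W.IsElliptic] [W.IsGloballyMinimal] [NeZero (W.conductorNorm ℤ)], ¬ W.HasCM → Literature.NumberTheory.EllipticCurves.Rank1Residual.Addv W 3 → Summit.BirchSwinnertonDyer.Rank1Residual.Additive.SubTprime W 3 → W.HasIrreducibleModPGaloisRep 3 → padicValInt 3 W.minimalDiscriminantInt = 3 → ∀ (D : Literature.NumberTheory.EllipticCurves.ModularForms.ModularParametrizationData W (W.conductorNorm ℤ)), (∀ z ∈ D.L.lattice, ∃ w ∈ Literature.NumberTheory.EllipticCurves.ModularForms.periodLattice D.f, z = D.c * w) → (∀ (W' : WeierstrassCurve ℚ) [W'.IsElliptic] (D' : Literature.NumberTheory.EllipticCurves.ModularForms.ModularParametrizationData W' (W.conductorNorm ℤ)), D'.f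 = D.f → D.modularDegree ≤ D'.modularDegree) → 3 ∣ D.modularDegree → ¬ (3 : ℤ) ∣ D.maninConstant) :
    TprimeIrrTwistLatticeOrientation :=
  tprimeIrrTwistLatticeOrientation_of_partner_of_cns_of_IIIRows
    (tprimeIrrTwistPartnerOptimalDatum_of_modularity_of_dokchitser hnf
      dokchitser_padicValInt_minimalDiscriminantInt_eq_of_isogeny_of_not_dvd_degree_holds)
    (tprimeIrrManinUnitOfDegreePrimeToThree_of_cns hCNS) hIII

end Summit.BirchSwinnertonDyer.BirchSwinnertonDyer.Theorems.TameQuarticManinParity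

end
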